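import Literature.NumberTheory.Transcendental.KaehlerHodge
import Literature.NumberTheory.Transcendental.KaehlerHodgeStarStarProofs
import Literature.NumberTheory.Transcendental.ComplexFormsProofs
import Literature.NumberTheory.Transcendental.DolbeaultIntegrabilityProofs
import Literature.Geometry.Kaehler.HodgeStarFrame
import Mathlib.RingTheory.Complex
import Mathlib.RingTheory.Norm.Transitivity

/-!
# The `ℂ`-linear Hodge star of a Hermitian metric respects types (proofs)

Theorems-only companion file of `Literature/NumberTheory/Transcendental/KaehlerHodge.lean` (C12),
first half of the proof of the bihomogeneity of `Δ_∂̄` (Huybrechts (2005), Prop. 3.2.6 (i);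
Voisin (2002), §6.1.2, proof of Cor. 6.8) used to reduce the named fact
`Literature.NumberTheory.Transcendental.typeComponent_mem_charmonicForms` (Voisin (2002), Cor. 6.9)
to the Kähler identity `Δ_d = 2Δ_∂̄` (see `KaehlerHodgeTypeProofs.lean`). Contents:

* `hodgeStar_compContinuousLinearMap_of_inner_eq`: the pointwise Hodge star
  `Literature.Geometry.Kaehler.hodgeStar` of an oriented inner product space commutes with pull-back
  along an orientation-preserving isometry `T` (`⋆(T^*β) = T^*(⋆β)`), from the basis independence
  of `⋆` (`hodgeStar_eq_hodgeStarFrame`, Warner, GTM 94, Ch. 2, Ex. 13) and its naturality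
  (`hodgeStarFrame_compContinuousLinearMap`) together with `vol ∘ T = vol`
  (Mathlib `Orientation.volumeForm_comp_linearIsometryEquiv`);
* the rotations `e^{iθ}` (`Literature.NumberTheory.Transcendental.tangentRotate`) of the tangent
  spaces of a complex manifold are isometries of any **Hermitian** metric
  (`inner_tangentRotate_tangentRotate`, from `g(Jv, Jw) = g(v, w)` and `e^{iθ} = cos θ + sin θ J`)
  of determinant `1` (`det_tangentRotate`), hence commute with the `ℂ`-linear Hodge star
  `Literature.Geometry.Kaehler.MForm.cHodgeStar` (`cHodgeStar_compContinuousLinearMap_tangentRotate`);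
* consequently **`⋆` maps forms of type `(p,q)` to forms of type `(d-q,d-p)`**, `d = dim_ℂ`
  (Huybrechts (2005), Lemma 1.2.24 (ii)) — `IsOfType.cHodgeStar`, stated with the complementary
  type `(p',q')` bound by `p' + q' = m`, `p' - q' = p - q` (no natural subtraction) — and
  **`⋆ ∘ Π^{p,q} = Π^{d-q,d-p} ∘ ⋆`** (Huybrechts (2005), Exercise 1.2.3) — `cHodgeStar_typeComponent`;
* on the way: a complex `m`-form transforming under `e^{iθ}` with a weight `w`, `|w| > m`, is zero
  (`eq_zero_of_forall_apply_comp_tangentRotate`; the frequencies of an `m`-form lie in `[-m, m]`,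
  `MForm.exists_fourier`), whence **forms of type `(p,q)` with `p > d` or `q > d` vanish**
  (`IsOfType.eq_zero_of_finrank_lt_or_lt`: the `m`-form `⋆α`, `m = 2d - p - q`, has weight
  `p - q ∉ [-m, m]`, and `⋆⋆ = ±1`), extending `IsOfType.eq_zero_of_finrank_lt_left/right` of
  `ComplexFormsHighType.lean` (types `(p,0)`, `(0,q)`) in the presence of a Hermitian metric.

Recall (`ComplexForms.lean`) that in this library "type `(p,q)`" of a `k`-form is the `U(1)`-weight
condition `α(e^{iθ}v) = e^{i(p-q)θ} α(v)` with `p + q = k`, and `Π^{p,q} = typeComponent p q` is the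
finite Fourier average; all statements here are pointwise linear algebra, valid for any Riemannian
metric on the real tangent bundle which is Hermitian at each point, given in the instance form
`hH : ∀ x v w, ⟪J v, J w⟫ = ⟪v, w⟫` for the ambient `[RiemannianBundle]` (for a metric term `g`
installed by `letI : RiemannianBundle _ := ⟨g.toRiemannianMetric⟩` this is literally
`g.toRiemannianMetric.IsHermitian`, see `KaehlerHodgeTypeProofs.lean`). No smoothness, compactness
or Kähler condition is involved.

## References

* D. Huybrechts, *Complex Geometry. An Introduction*, Universitext, Springer (2005), §1.2,
  Lemma 1.2.24 (ii) (p. 33) and Exercise 1.2.3 (p. 41: `*Π^{p,q} = Π^{n-q,n-p}*`); §3.2,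
  Prop. 3.2.6 (i) and Remark 3.2.7 (i).
* C. Voisin, *Hodge Theory and Complex Algebraic Geometry I*, Cambridge Studies in Advanced
  Mathematics 76 (2002), §5.1.3 (Lemma 5.8, `∂̄* = -⋆∂⋆`), §6.1.2 (Thm. 6.7, Cor. 6.8, Cor. 6.9).
* F. W. Warner, *Foundations of Differentiable Manifolds and Lie Groups*, GTM 94 (1983), Ch. 2,
  Exercise 13; 6.1.
-/

noncomputable section

open scoped Manifold ContDiff Topology ComplexConjugate RealInnerProductSpace
open Bundle Module Set Finset

namespace Literature.NumberTheory.Transcendental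

/-! ### Pointwise: the Hodge star commutes with orientation-preserving isometries -/

section Pointwise

variable {V : Type*} [NormedAddCommGroup V] [InnerProductSpace ℝ V] [FiniteDimensional ℝ V]
  {n : ℕ} [Fact (finrank ℝ V = n)] (o : Orientation ℝ V (Fin n)) {k m : ℕ}

/-- **The Hodge star commutes with orientation-preserving isometries.** For a continuous linear map
`T` of the oriented inner product space `V` preserving inner products and with `det T > 0`, and a
`k`-form `β`, `⋆(β ∘ T) = (⋆β) ∘ T`. Proof: compute `⋆β` in the orthonormal frame `T ∘ b`
(`hodgeStar_eq_hodgeStarFrame`, basis independence of `⋆`; Warner, GTM 94, Ch. 2, Ex. 13 (2)–(3)),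
pull back along `T` (`hodgeStarFrame_compContinuousLinearMap`) and use `vol ∘ T = vol`
(`Orientation.volumeForm_comp_linearIsometryEquiv`). [folklore] -/
theorem hodgeStar_compContinuousLinearMap_of_inner_eq (h : k + m = n) (T : V →L[ℝ] V)
    (hT : ∀ v w, ⟪T v, T w⟫ = ⟪v, w⟫) (hdet : 0 < LinearMap.det (T : V →ₗ[ℝ] V))
    (β : V [⋀^Fin k]→L[ℝ] ℝ) :
    Literature.Geometry.Kaehler.hodgeStar o h (β.compContinuousLinearMap T) =
      (Literature.Geometry.Kaehler.hodgeStar o h β).compContinuousLinearMap T := by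
  set Te : V ≃ₗᵢ[ℝ] V := ((T : V →ₗ[ℝ] V).isometryOfInner hT).toLinearIsometryEquiv rfl
  have hTe : ⇑Te = ⇑T := rfl
  set b := Literature.Geometry.Kaehler.stdOrthonormalBasisFin V n
  have hb : ⇑(b.map Te) = ⇑T ∘ ⇑b := by
    funext i
    simp [hTe]
  have hvol : o.volumeFormL.compContinuousLinearMap T = o.volumeFormL := by
    ext v
    have hdet' : 0 < LinearMap.det (Te.toLinearEquiv : V →ₗ[ℝ] V) := by
      have : (Te.toLinearEquiv : V →ₗ[ℝ] V) = (T : V →ₗ[ℝ] V) := by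
        ext v; rfl
      rwa [this]
    have := o.volumeForm_comp_linearIsometryEquiv Te hdet' v
    rw [hTe] at this
    simpa using this
  rw [Literature.Geometry.Kaehler.hodgeStar_eq_hodgeStarFrame o (b.map Te) h β, hb,
    Literature.Geometry.Kaehler.hodgeStarFrame_compContinuousLinearMap, hvol,
    ← Literature.Geometry.Kaehler.hodgeStar_eq_hodgeStarFrame o b h]

end Pointwise

/-! ### The rotations `e^{iθ}` of the tangent spaces of a Hermitian manifold -/

section Rotation

variable {E : Type*} [NormedAddCommGroup E] [NormedSpace ℂ E]
  {M : Type*} [TopologicalSpace M] [ChartedSpace E M] {k m : ℕ}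

/-- **`det_ℝ e^{iθ} = 1`** on the real tangent space `T_x M = E` of a complex manifold: the real
determinant of the `ℂ`-linear map `e^{iθ} · id` is the norm `N_{ℂ/ℝ}(det_ℂ) = |e^{iθ}|^{2d} = 1`
(Mathlib `LinearMap.det_restrictScalars`, `Algebra.norm_complex_apply`). In particular the
rotations preserve every orientation of `T_x M`. [folklore] -/
theorem det_tangentRotate [FiniteDimensional ℂ E] (x : M) (θ : ℝ) :
    LinearMap.det ((tangentRotate E x θ : TangentSpace 𝓘(ℝ, E) x →L[ℝ] TangentSpace 𝓘(ℝ, E) x) :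
      TangentSpace 𝓘(ℝ, E) x →ₗ[ℝ] TangentSpace 𝓘(ℝ, E) x) = 1 := by
  change LinearMap.det (((Complex.exp (θ * Complex.I) • ContinuousLinearMap.id ℂ E).restrictScalars ℝ :
    E →L[ℝ] E) : E →ₗ[ℝ] E) = 1
  have h1 : (((Complex.exp (θ * Complex.I) • ContinuousLinearMap.id ℂ E).restrictScalars ℝ :
      E →L[ℝ] E) : E →ₗ[ℝ] E) =
      ((Complex.exp (θ * Complex.I) • LinearMap.id : E →ₗ[ℂ] E)).restrictScalars ℝ := by
    ext v; rfl
  rw [h1, LinearMap.det_restrictScalars, LinearMap.det_smul, LinearMap.det_id, mul_one, map_pow,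
    Algebra.norm_complex_apply, Complex.normSq_eq_norm_sq, Complex.norm_exp_ofReal_mul_I]
  simp

/-- **An `m`-form of pure weight `w` with `|w| > m` vanishes.** If a complex `m`-form `γ`
transforms under all rotations by `γ(e^{iθ}v) = e^{iwθ} γ(v)` with `|w| > m`, then `γ = 0`: along
a rotating frame `θ ↦ γ(e^{iθ}v)` is a trigonometric polynomial with frequencies in `[-m, m]`
(`MForm.exists_fourier`), and averaging `e^{-iwθⱼ} γ(e^{iθⱼ}v)` over the `(2|w|+1)`-st roots of
unity gives `γ(v)` on the one hand and `0` on the other (character orthogonality,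
`sum_exp_mul_rootAngle_mul_I_eq_zero`, all `|f - w| ≤ 2|w|`, `f ≠ w`). This is the statement that
the `U(1)`-weights of `Λ^m (E_ℝ)^* ⊗ ℂ` lie in `[-m, m]` (Voisin (2002), §2.3.1; Wells (1980),
Ch. I §3). [folklore] -/
theorem eq_zero_of_forall_apply_comp_tangentRotate
    {γ : Literature.Geometry.Kaehler.MForm 𝓘(ℝ, E) M ℂ m} {w : ℤ}
    (hγ : ∀ (x : M) (θ : ℝ) (v : Fin m → TangentSpace 𝓘(ℝ, E) x),
      γ x (⇑(tangentRotate E x θ) ∘ v) = Complex.exp (w * θ * Complex.I) * γ x v)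
    (hw : m < w.natAbs) : γ = 0 := by
  funext x; ext v
  obtain ⟨P, hP, hPev⟩ := γ.exists_fourier x v
  set K : ℕ := w.natAbs with hK
  have hS1 : ∑ j : Fin (2 * K + 1),
      Complex.exp (-(((w * (2 * Real.pi * j / (2 * K + 1)) : ℝ) : ℂ)) * Complex.I) *
        γ x (⇑(tangentRotate E x (2 * Real.pi * j / (2 * K + 1))) ∘ v) =
      ((2 * K + 1 : ℕ) : ℂ) * γ x v := by
    have hterm : ∀ j : Fin (2 * K + 1),
        Complex.exp (-(((w * (2 * Real.pi * j / (2 * K + 1)) : ℝ) : ℂ)) * Complex.I) *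
          γ x (⇑(tangentRotate E x (2 * Real.pi * j / (2 * K + 1))) ∘ v) = γ x v := by
      intro j
      rw [hγ, ← mul_assoc, ← Complex.exp_add]
      have : -(((w * (2 * Real.pi * j / (2 * K + 1)) : ℝ) : ℂ)) * Complex.I +
          w * ((2 * Real.pi * j / (2 * K + 1) : ℝ) : ℂ) * Complex.I = 0 := by
        push_cast; ring
      rw [this, Complex.exp_zero, one_mul]
    simp only [hterm, Finset.sum_const, Finset.card_univ, Fintype.card_fin, nsmul_eq_mul]
  have hS2 : ∑ j : Fin (2 * K + 1),
      Complex.exp (-(((w * (2 * Real.pi * j / (2 * K + 1)) : ℝ) : ℂ)) * Complex.I) *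
        γ x (⇑(tangentRotate E x (2 * Real.pi * j / (2 * K + 1))) ∘ v) = 0 := by
    simp only [hPev, Finset.mul_sum]
    rw [Finset.sum_comm]
    refine Finset.sum_eq_zero fun f hf ↦ ?_
    have hterm : ∀ j : Fin (2 * K + 1),
        Complex.exp (-(((w * (2 * Real.pi * j / (2 * K + 1)) : ℝ) : ℂ)) * Complex.I) *
          (P.coeff f * Complex.exp (f * ((2 * Real.pi * j / (2 * K + 1) : ℝ) : ℂ) * Complex.I)) =
        P.coeff f * Complex.exp (((f - w : ℤ) : ℂ) * ((2 * Real.pi * j / (2 * K + 1) : ℝ) : ℂ) *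
            Complex.I) := by
      intro j
      rw [mul_left_comm, ← Complex.exp_add]
      congr 2
      push_cast; ring
    simp only [hterm, ← Finset.mul_sum]
    have hfK := hP f hf
    rw [sum_exp_mul_rootAngle_mul_I_eq_zero (by omega) (by omega), mul_zero]
  have h0 : ((2 * K + 1 : ℕ) : ℂ) * γ x v = 0 := hS1 ▸ hS2
  have hC : ((2 * K + 1 : ℕ) : ℂ) ≠ 0 := by exact_mod_cast Nat.succ_ne_zero (2 * K)
  exact (mul_eq_zero.mp h0).resolve_left hC

variable [FiniteDimensional ℂ E] {n : ℕ} [Fact (finrank ℝ E = n)]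
  [RiemannianBundle (fun x : M ↦ TangentSpace 𝓘(ℝ, E) x)]

omit [FiniteDimensional ℂ E] in
/-- **The rotations `e^{iθ}` are isometries of a Hermitian metric**: if the metric of the tangent
space at `x` is `J`-invariant, `⟪Jv, Jw⟫ = ⟪v, w⟫`, then `⟪e^{iθ}v, e^{iθ}w⟫ = ⟪v, w⟫`
(`e^{iθ} = cos θ + sin θ · J`, `tangentRotate_eq_cos_add_sin_tangentJ`, and `⟪Jv, w⟫ = -⟪v, Jw⟫`).
Voisin (2002), §3.1.1 (a Hermitian form is `U(1)`-invariant); Huybrechts (2005), §1.2. [folklore] -/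
theorem inner_tangentRotate_tangentRotate {x : M}
    (hH : ∀ v w : TangentSpace 𝓘(ℝ, E) x,
      ⟪Literature.Geometry.Kaehler.tangentJ E x v, Literature.Geometry.Kaehler.tangentJ E x w⟫ = ⟪v, w⟫)
    (θ : ℝ) (v w : TangentSpace 𝓘(ℝ, E) x) :
    ⟪tangentRotate E x θ v, tangentRotate E x θ w⟫ = ⟪v, w⟫ := by
  have hJ : ∀ a b : TangentSpace 𝓘(ℝ, E) x,
      ⟪Literature.Geometry.Kaehler.tangentJ E x a, b⟫ =
        -⟪a, Literature.Geometry.Kaehler.tangentJ E x b⟫ := by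
    intro a b
    have := hH (Literature.Geometry.Kaehler.tangentJ E x a) b
    rw [Literature.Geometry.Kaehler.tangentJ_tangentJ, inner_neg_left] at this
    linarith
  rw [tangentRotate_eq_cos_add_sin_tangentJ, tangentRotate_eq_cos_add_sin_tangentJ]
  simp only [inner_add_left, inner_add_right, real_inner_smul_left, real_inner_smul_right, hH,
    hJ v w]
  have := Real.cos_sq_add_sin_sq θ
  linear_combination ⟪v, w⟫ * this

variable (o : (x : M) → Orientation ℝ (TangentSpace 𝓘(ℝ, E) x) (Fin n))

/-- **The pointwise Hodge star of a Hermitian metric commutes with the rotations `e^{iθ}`** of the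
tangent space (for any orientation): `⋆(β ∘ e^{iθ}) = (⋆β) ∘ e^{iθ}`
(`hodgeStar_compContinuousLinearMap_of_inner_eq` with `inner_tangentRotate_tangentRotate` and
`det_tangentRotate`). Huybrechts (2005), §1.2 (proof of Lemma 1.2.24). [folklore] -/
theorem hodgeStar_compContinuousLinearMap_tangentRotate {x : M}
    (hH : ∀ v w : TangentSpace 𝓘(ℝ, E) x,
      ⟪Literature.Geometry.Kaehler.tangentJ E x v, Literature.Geometry.Kaehler.tangentJ E x w⟫ = ⟪v, w⟫)
    (h : k + m = n) (θ : ℝ) (β : TangentSpace 𝓘(ℝ, E) x [⋀^Fin k]→L[ℝ] ℝ) :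
    Literature.Geometry.Kaehler.hodgeStar (o x) h (β.compContinuousLinearMap (tangentRotate E x θ)) =
      (Literature.Geometry.Kaehler.hodgeStar (o x) h β).compContinuousLinearMap (tangentRotate E x θ) :=
  hodgeStar_compContinuousLinearMap_of_inner_eq (o x) h _ (inner_tangentRotate_tangentRotate hH θ)
    (by rw [det_tangentRotate]; exact one_pos) β

/-- **The `ℂ`-linear Hodge star of a Hermitian metric commutes with the rotations `e^{iθ}`**, as an
identity of complex forms: `⋆(x ↦ α(x) ∘ e^{iθ}) = (x ↦ (⋆α)(x) ∘ e^{iθ})`. The complex star is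
the `ℂ`-linear extension of the real one (`MForm.cHodgeStar_apply`), and taking real/imaginary
parts commutes with pull-back. Huybrechts (2005), §1.2, p. 33 and Lemma 1.2.24. [folklore] -/
theorem cHodgeStar_compContinuousLinearMap_tangentRotate
    (hH : ∀ (x : M) (v w : TangentSpace 𝓘(ℝ, E) x),
      ⟪Literature.Geometry.Kaehler.tangentJ E x v, Literature.Geometry.Kaehler.tangentJ E x w⟫ = ⟪v, w⟫)
    (h : k + m = n) (θ : ℝ) (α : Literature.Geometry.Kaehler.MForm 𝓘(ℝ, E) M ℂ k) :
    Literature.Geometry.Kaehler.MForm.cHodgeStar o h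
        (fun x ↦ (α x).compContinuousLinearMap (tangentRotate E x θ)) =
      fun x ↦ (Literature.Geometry.Kaehler.MForm.cHodgeStar o h α x).compContinuousLinearMap
        (tangentRotate E x θ) := by
  funext x; ext v
  have hre : Literature.Geometry.Kaehler.MForm.re
      (fun x ↦ (α x).compContinuousLinearMap (tangentRotate E x θ) :
        Literature.Geometry.Kaehler.MForm 𝓘(ℝ, E) M ℂ k) x =
      (α.re x).compContinuousLinearMap (tangentRotate E x θ) := by
    ext w; rfl
  have him : Literature.Geometry.Kaehler.MForm.im
      (fun x ↦ (α x).compContinuousLinearMap (tangentRotate E x θ) :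
        Literature.Geometry.Kaehler.MForm 𝓘(ℝ, E) M ℂ k) x =
      (α.im x).compContinuousLinearMap (tangentRotate E x θ) := by
    ext w; rfl
  simp only [Literature.Geometry.Kaehler.MForm.cHodgeStar_apply, Pi.add_apply, Pi.smul_apply,
    ContinuousAlternatingMap.add_apply, ContinuousAlternatingMap.smul_apply,
    Literature.Geometry.Kaehler.MForm.ofReal_apply, Literature.Geometry.Kaehler.MForm.hodgeStar_apply,
    hre, him, hodgeStar_compContinuousLinearMap_tangentRotate o (hH x) h,
    ContinuousAlternatingMap.compContinuousLinearMap_apply]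

/-- **`⋆` preserves `U(1)`-weights.** If `α` has type `(p,q)` then `⋆α` transforms under the
rotations with the same weight: `(⋆α)(e^{iθ}v) = e^{i(p-q)θ} (⋆α)(v)` (the star is `ℂ`-linear and
commutes with `e^{iθ}`, `cHodgeStar_compContinuousLinearMap_tangentRotate`). This is the content of
Huybrechts (2005), Lemma 1.2.24 (ii) (`⋆ : Λ^{p,q} → Λ^{d-q,d-p}`, same weight `p - q`) before the
degree bookkeeping of `IsOfType.cHodgeStar`. [cite: Huybrechts2005, Lemma 1.2.24 (ii)] -/
theorem IsOfType.cHodgeStar_apply_comp_tangentRotate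
    (hH : ∀ (x : M) (v w : TangentSpace 𝓘(ℝ, E) x),
      ⟪Literature.Geometry.Kaehler.tangentJ E x v, Literature.Geometry.Kaehler.tangentJ E x w⟫ = ⟪v, w⟫)
    (h : k + m = n) {p q : ℕ} {α : Literature.Geometry.Kaehler.MForm 𝓘(ℝ, E) M ℂ k}
    (hα : IsOfType p q α) (x : M) (θ : ℝ) (v : Fin m → TangentSpace 𝓘(ℝ, E) x) :
    Literature.Geometry.Kaehler.MForm.cHodgeStar o h α x (⇑(tangentRotate E x θ) ∘ v) =
      Complex.exp (((p : ℤ) - q : ℤ) * θ * Complex.I) *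
        Literature.Geometry.Kaehler.MForm.cHodgeStar o h α x v := by
  have hrot : (fun x ↦ (α x).compContinuousLinearMap (tangentRotate E x θ) :
      Literature.Geometry.Kaehler.MForm 𝓘(ℝ, E) M ℂ k) =
      Complex.exp (((p : ℤ) - q : ℤ) * θ * Complex.I) • α := by
    funext y; ext w
    simp only [ContinuousAlternatingMap.compContinuousLinearMap_apply, Pi.smul_apply,
      ContinuousAlternatingMap.smul_apply, smul_eq_mul]
    exact hα.2 y θ w
  have key := congrFun (cHodgeStar_compContinuousLinearMap_tangentRotate o hH h θ α) x
  rw [hrot, map_smul] at key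
  have := DFunLike.congr_fun key v
  simpa [ContinuousAlternatingMap.compContinuousLinearMap_apply] using this.symm

/-- **The Hodge star maps `(p,q)`-forms to `(d-q,d-p)`-forms** (`d = dim_ℂ`, Hermitian metric,
`ℂ`-linear star `Ωᵏ_ℂ → Ωᵐ_ℂ`, `k + m = 2d`): Huybrechts (2005), Lemma 1.2.24 (ii); Voisin (2002),
§5.1.3. Stated without natural subtraction: `⋆α` has every type `(p',q')` with `p' + q' = m` and
`p' - q' = p - q` (there is exactly one such pair when `p, q ≤ d`, namely `(d-q, d-p)`).
[cite: Huybrechts2005, Lemma 1.2.24 (ii)] -/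
theorem IsOfType.cHodgeStar
    (hH : ∀ (x : M) (v w : TangentSpace 𝓘(ℝ, E) x),
      ⟪Literature.Geometry.Kaehler.tangentJ E x v, Literature.Geometry.Kaehler.tangentJ E x w⟫ = ⟪v, w⟫)
    (h : k + m = n) {p q p' q' : ℕ} {α : Literature.Geometry.Kaehler.MForm 𝓘(ℝ, E) M ℂ k}
    (hα : IsOfType p q α) (hpq' : p' + q' = m) (hw : (p' : ℤ) - q' = (p : ℤ) - q) :
    IsOfType p' q' (Literature.Geometry.Kaehler.MForm.cHodgeStar o h α) :=
  ⟨hpq', fun x θ v ↦ by rw [hw]; exact hα.cHodgeStar_apply_comp_tangentRotate o hH h x θ v⟩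

include o in
/-- **Forms of type `(p,q)` with `p > d` or `q > d` vanish** (`d = dim_ℂ E`; `Λ^{p,q} = Λ^p T^{*1,0} ⊗
Λ^q T^{*0,1}`, Voisin (2002), §2.3.1; Huybrechts (2005), §1.2), here for a `k`-form on a manifold
with a Hermitian metric and `k + m = 2d`: the `m`-form `⋆α` has weight `p - q`
(`IsOfType.cHodgeStar_apply_comp_tangentRotate`) with `|p - q| > m = 2d - p - q`, so `⋆α = 0`
(`eq_zero_of_forall_apply_comp_tangentRotate`) and `α = ±⋆⋆α = 0` (`MForm.cHodgeStar_cHodgeStar`).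
The metric and the orientation enter the proof only. [folklore] -/
theorem IsOfType.eq_zero_of_finrank_lt_or_lt
    (hH : ∀ (x : M) (v w : TangentSpace 𝓘(ℝ, E) x),
      ⟪Literature.Geometry.Kaehler.tangentJ E x v, Literature.Geometry.Kaehler.tangentJ E x w⟫ = ⟪v, w⟫)
    (h : k + m = n) {p q : ℕ} {α : Literature.Geometry.Kaehler.MForm 𝓘(ℝ, E) M ℂ k}
    (hα : IsOfType p q α) (hlt : finrank ℂ E < p ∨ finrank ℂ E < q) : α = 0 := by
  have hn : n = 2 * finrank ℂ E := by
    rw [← (Fact.out : finrank ℝ E = n), finrank_real_of_complex]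
  have hk := hα.1
  have hstar : Literature.Geometry.Kaehler.MForm.cHodgeStar o h α = 0 := by
    refine eq_zero_of_forall_apply_comp_tangentRotate (w := (p : ℤ) - q)
      (fun x θ v ↦ hα.cHodgeStar_apply_comp_tangentRotate o hH h x θ v) ?_
    omega
  have := Literature.Geometry.Kaehler.MForm.cHodgeStar_cHodgeStar_holds o h
    (show m + k = n by omega) α
  rw [hstar, map_zero] at this
  exact (smul_eq_zero_iff_right (pow_ne_zero _ (neg_ne_zero.mpr one_ne_zero))).mp this.symm

include o in
/-- **`Π^{p,q} = 0` on `k`-forms when `p > d` or `q > d`** (`d = dim_ℂ E`; Hermitian metric on the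
tangent bundle, `k + m = 2d`): the `(p,q)`-component has type `(p,q)` (`isOfType_typeComponent`)
and such forms vanish (`IsOfType.eq_zero_of_finrank_lt_or_lt`); off the antidiagonal it is `0` by
definition. Voisin (2002), §2.3.1. [folklore] -/
theorem typeComponent_eq_zero_of_finrank_lt_or_lt
    (hH : ∀ (x : M) (v w : TangentSpace 𝓘(ℝ, E) x),
      ⟪Literature.Geometry.Kaehler.tangentJ E x v, Literature.Geometry.Kaehler.tangentJ E x w⟫ = ⟪v, w⟫)
    (h : k + m = n) {p q : ℕ} (hlt : finrank ℂ E < p ∨ finrank ℂ E < q)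
    (β : Literature.Geometry.Kaehler.MForm 𝓘(ℝ, E) M ℂ k) : β.typeComponent p q = 0 := by
  by_cases hpq : p + q = k
  · exact (isOfType_typeComponent_holds hpq β).eq_zero_of_finrank_lt_or_lt o hH h hlt
  · exact Literature.Geometry.Kaehler.MForm.typeComponent_of_ne hpq β

/-- **`⋆ ∘ Π^{p,q} = Π^{d-q,d-p} ∘ ⋆`** for the `ℂ`-linear Hodge star of a Hermitian metric
(Huybrechts (2005), Exercise 1.2.3, p. 41; from Lemma 1.2.24 (ii) and the directness of the type
decomposition): for `p + q = k`, `p' + q' = m` (`k + m = 2d`) and `p' - q' = p - q`,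
`⋆(β^{p,q}) = (⋆β)^{p',q'}`. Proof: decompose `β = ∑_{a+b=k} β^{a,b}`
(`sum_antidiagonal_typeComponent`); `⋆β^{a,b}` has type `(d-b, d-a) ≠ (p',q')` for
`(a,b) ≠ (p,q)` with `a, b ≤ d` (`IsOfType.cHodgeStar`, `IsOfType.typeComponent_of_ne`), and
`β^{a,b} = 0` when `a > d` or `b > d` (`typeComponent_eq_zero_of_finrank_lt_or_lt`).
[cite: Huybrechts2005, Exercise 1.2.3] -/
theorem cHodgeStar_typeComponent
    (hH : ∀ (x : M) (v w : TangentSpace 𝓘(ℝ, E) x),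
      ⟪Literature.Geometry.Kaehler.tangentJ E x v, Literature.Geometry.Kaehler.tangentJ E x w⟫ = ⟪v, w⟫)
    (h : k + m = n) {p q p' q' : ℕ} (hpq : p + q = k) (hpq' : p' + q' = m)
    (hw : (p' : ℤ) - q' = (p : ℤ) - q) (β : Literature.Geometry.Kaehler.MForm 𝓘(ℝ, E) M ℂ k) :
    Literature.Geometry.Kaehler.MForm.cHodgeStar o h (β.typeComponent p q) =
      (Literature.Geometry.Kaehler.MForm.cHodgeStar o h β).typeComponent p' q' := by
  have hn : n = 2 * finrank ℂ E := by
    rw [← (Fact.out : finrank ℝ E = n), finrank_real_of_complex]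
  have ht : IsOfType p' q' (Literature.Geometry.Kaehler.MForm.cHodgeStar o h (β.typeComponent p q)) :=
    (isOfType_typeComponent_holds hpq β).cHodgeStar o hH h hpq' hw
  conv_rhs => rw [← sum_antidiagonal_typeComponent_holds β]
  rw [map_sum, Literature.Geometry.Kaehler.MForm.typeComponent_sum, ← ht.typeComponent_eq_self,
    Finset.sum_eq_single (p, q)]
  · rintro ⟨a, b⟩ hab hne
    rw [mem_antidiagonal] at hab
    have hne' : ¬(a = p ∧ b = q) := fun hh ↦ hne (by rw [hh.1, hh.2])
    by_cases hbd : finrank ℂ E < a ∨ finrank ℂ E < b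
    · rw [typeComponent_eq_zero_of_finrank_lt_or_lt o hH h hbd β, map_zero,
        Literature.Geometry.Kaehler.MForm.typeComponent_zero]
    · push Not at hbd
      obtain ⟨a', ha'⟩ := Nat.exists_eq_add_of_le hbd.2
      obtain ⟨b', hb'⟩ := Nat.exists_eq_add_of_le hbd.1
      have ht' : IsOfType a' b'
          (Literature.Geometry.Kaehler.MForm.cHodgeStar o h (β.typeComponent a b)) :=
        (isOfType_typeComponent_holds hab β).cHodgeStar o hH h (by omega) (by push_cast; omega)
      exact IsOfType.typeComponent_of_ne_holds ht' (by omega)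
  · intro hmem
    exact absurd (mem_antidiagonal.mpr hpq) hmem

end Rotation

end Literature.NumberTheory.Transcendental
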